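import Literature.Geometry.Kaehler.ComplexTorus
import Literature.AlgebraicTopology.SingularHomology.TorusCohomologyIntegral
import Literature.AlgebraicGeometry.HodgeTheory.ComplexTorusHodgeNumbers
import HarnessLib

/-!
# The integral cohomology of a complex torus: `Hᵏ(X; ℤ)` is free of rank `C(2g, k)`

Layer A1 of the Hodge foundations lane (`lit-hodgefound`), validation instances demanded by
TRIBUNAL-A §2 (A1 (iii) "`finrank ℤ H¹(T, ℤ) = 2·dim T`"; "`finrank Hᵏ = choose (2g) k`; `Hᵏ = 0` for
`k > 2g`; `H^{2g}` rank 1") for the tree's complex torus `X = E/Φ(ℤ^ι)`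
(`Literature.Geometry.Kaehler.ComplexTorus Φ`, `Φ : ℝ^ι ≃L[ℝ] E` a period isomorphism, `|ι| = 2g`,
`g = dim_ℂ E`), with INTEGRAL coefficients.

Lange–Birkenhake, *Complex Abelian Varieties* (1992) = Lange, *Abelian Varieties over the Complex
Numbers* (2023, the held text edition; same numbering in §1.1 — key of record for the PDF pages per
TRIBUNAL-A §5), §1.1.1 ("a lattice […] is a free abelian group of rank `2g`", PDF p. 16), §1.1.3:
Lemma 1.1.17 (a) "`H¹(X, ℤ) = Hom(Λ, ℤ)`" (PDF p. 23), Exercise 1.1.6 (8) "`Hⁿ(X, ℤ)` [is a] free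
`ℤ`-module of rank `C(2g, n)`" (PDF p. 27); Mumford, *Abelian Varieties* §1 (3)–(4); Hatcher (2002)
Example 3.16 (`R = ℤ`).

As a topological space `ComplexTorus Φ` is literally `ι → ℝ/ℤ` (`ComplexTorus.toRealTorus` is the
identity), homeomorphic to the standard torus `Torus |ι| = (ℝ/ℤ)^{|ι|}` of
`AlgebraicTopology/SingularHomology/TorusCohomology.lean` by reindexing (`toTorus`); the statements are
transported from the PROVED integral cup-monomial basis of `Hᵏ((ℝ/ℤ)ⁿ; ℤ)`
(`torusMonomialBasisInt'`, `finrank_singularCohomology_torus_int'`, file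
`AlgebraicTopology/SingularHomology/TorusCohomologyIntegral.lean`, discharged fact
`span_torusMonomial_int`). Everything here is PROVED; no named fact.

## Main statements

* `ComplexTorus.toTorus Φ : ComplexTorus Φ ≃ₜ Torus (Fintype.card ι)`;
  `singularCohomologyIntEquiv Φ k : Hᵏ(X; ℤ) ≃ₗ[ℤ] Hᵏ(T^{|ι|}; ℤ)`; `singularCohomologyIntBasis Φ k`.
* `finrank_singularCohomology_int Φ k : rank_ℤ Hᵏ(X; ℤ) = C(|ι|, k) = C(2g, k)`
  (`…_eq_choose_two_mul`), instances `Module.Free ℤ`, `Module.Finite ℤ`;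
  `finrank_singularCohomology_int_one : rank_ℤ H¹(X; ℤ) = 2g` (TRIBUNAL-A A1 (iii));
  `finrank_singularCohomology_int_top : rank_ℤ H^{2g}(X; ℤ) = 1`;
  `finrank_singularCohomology_int_eq_zero_of_lt : rank_ℤ Hᵏ(X; ℤ) = 0` for `k > 2g`.

## References

* H. Lange, *Abelian Varieties over the Complex Numbers*, Grundlehren Text Editions (2023), §1.1.1,
  §1.1.3 Lemma 1.1.17, Exercise 1.1.6 (8) (held copy, PDF pp. 16, 23, 27). [Lange2023AbelianVarietiesComplex]
* H. Lange, Ch. Birkenhake, *Complex Abelian Varieties*, Grundlehren 302 (1992), §1.1 (same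
  numbering). [LangeBirkenhake1992]
* D. Mumford, *Abelian Varieties* (1970), §1 (3)–(4). [MumfordAV1970]
* A. Hatcher, *Algebraic Topology* (2002), §3.2 Example 3.16. [HatcherAT2002]
-/

noncomputable section

open Module
open Literature.AlgebraicTopology.SingularHomology

namespace Literature.Geometry.Kaehler

namespace ComplexTorus

universe u

variable {ι : Type} [Fintype ι] {E : Type u} [NormedAddCommGroup E] [NormedSpace ℂ E]
variable (Φ : (ι → ℝ) ≃L[ℝ] E)

/-- The complex torus `E/Φ(ℤ^ι)` is homeomorphic to the standard torus `(ℝ/ℤ)^{|ι|}` (reindex the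
factors of `ι → ℝ/ℤ` along `ι ≃ Fin |ι|`). [cite: Lange2023AbelianVarietiesComplex, §1.1.1 (PDF p. 16)] -/
def toTorus : ComplexTorus Φ ≃ₜ Torus (Fintype.card ι) :=
  (toRealTorus Φ).trans
    (Homeomorph.piCongrLeft (Y := fun _ : Fin (Fintype.card ι) ↦ AddCircle (1 : ℝ)) (Fintype.equivFin ι))

/-- `Hᵏ(E/Φ(ℤ^ι); ℤ) ≃ Hᵏ((ℝ/ℤ)^{|ι|}; ℤ)`, induced by the homeomorphism `toTorus`.
[cite: Lange2023AbelianVarietiesComplex, §1.1.3 Lemma 1.1.17 (PDF p. 23)] -/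
def singularCohomologyIntEquiv (k : ℕ) :
    singularCohomology ℤ ℤ (ComplexTorus Φ) k ≃ₗ[ℤ] singularCohomology ℤ ℤ (Torus (Fintype.card ι)) k :=
  (singularCohomology.mapIso ℤ ℤ (toTorus Φ) k).toLinearEquiv.symm

/-- **A `ℤ`-basis of `Hᵏ(X; ℤ)` indexed by the `k`-subsets of `Fin |ι| = Fin 2g`** (the transported
cup monomials `ξ_{i₁} ⌣ ⋯ ⌣ ξ_{i_k}`; Lange–Birkenhake Exercise 1.1.6 (8), Hatcher Example 3.16 with
`R = ℤ`). [cite: Lange2023AbelianVarietiesComplex, §1.1.3 Exercise 1.1.6 (8) (PDF p. 27)] [cite: HatcherAT2002, §3.2 Example 3.16] -/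
def singularCohomologyIntBasis (k : ℕ) :
    Module.Basis (Set.powersetCard (Fin (Fintype.card ι)) k) ℤ (singularCohomology ℤ ℤ (ComplexTorus Φ) k) :=
  (torusMonomialBasisInt' (Fintype.card ι) k).map (singularCohomologyIntEquiv Φ k).symm

/-- **`Hᵏ(X; ℤ)` is a free `ℤ`-module** (Lange–Birkenhake Exercise 1.1.6 (8)).
[cite: Lange2023AbelianVarietiesComplex, §1.1.3 Exercise 1.1.6 (8) (PDF p. 27)] -/
instance free_singularCohomology_int (k : ℕ) : Module.Free ℤ (singularCohomology ℤ ℤ (ComplexTorus Φ) k) :=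
  Module.Free.of_basis (singularCohomologyIntBasis Φ k)

/-- `Hᵏ(X; ℤ)` is finitely generated. [cite: Lange2023AbelianVarietiesComplex, §1.1.3 Exercise 1.1.6 (8) (PDF p. 27)] -/
instance finite_singularCohomology_int (k : ℕ) :
    Module.Finite ℤ (singularCohomology ℤ ℤ (ComplexTorus Φ) k) :=
  Module.Finite.of_basis (singularCohomologyIntBasis Φ k)

/-- **`rank_ℤ Hᵏ(X; ℤ) = C(|ι|, k)`** for the complex torus `X = E/Φ(ℤ^ι)`.
[cite: Lange2023AbelianVarietiesComplex, §1.1.3 Exercise 1.1.6 (8) (PDF p. 27)] -/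
theorem finrank_singularCohomology_int (k : ℕ) :
    finrank ℤ (singularCohomology ℤ ℤ (ComplexTorus Φ) k) = (Fintype.card ι).choose k := by
  rw [finrank_eq_card_basis (singularCohomologyIntBasis Φ k), card_powersetCard_fin]

/-- **`rank_ℤ Hᵏ(X; ℤ) = C(2g, k)`**, `g = dim_ℂ X` (Lange–Birkenhake Exercise 1.1.6 (8): "free
`ℤ`-modules of rank `C(2g, n)`"). [cite: Lange2023AbelianVarietiesComplex, §1.1.3 Exercise 1.1.6 (8) (PDF p. 27)] -/
theorem finrank_singularCohomology_int_eq_choose_two_mul (k : ℕ) :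
    finrank ℤ (singularCohomology ℤ ℤ (ComplexTorus Φ) k) = (2 * finrank ℂ E).choose k := by
  rw [finrank_singularCohomology_int,
    Literature.AlgebraicGeometry.HodgeTheory.card_eq_two_mul_finrank_of_periodIso Φ]

/-- **`rank_ℤ H¹(X; ℤ) = 2 dim_ℂ X`** (Lange–Birkenhake Lemma 1.1.17 (a): `H¹(X, ℤ) = Hom(Λ, ℤ)`,
`Λ ≅ ℤ^{2g}`; TRIBUNAL-A A1 instance (iii)). [cite: Lange2023AbelianVarietiesComplex, §1.1.3 Lemma 1.1.17 (a) (PDF p. 23)] -/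
theorem finrank_singularCohomology_int_one :
    finrank ℤ (singularCohomology ℤ ℤ (ComplexTorus Φ) 1) = 2 * finrank ℂ E := by
  rw [finrank_singularCohomology_int_eq_choose_two_mul, Nat.choose_one_right]

/-- **`rank_ℤ H^{2g}(X; ℤ) = 1`** (top degree). [cite: Lange2023AbelianVarietiesComplex, §1.1.3 Exercise 1.1.6 (8) (PDF p. 27)] -/
theorem finrank_singularCohomology_int_top :
    finrank ℤ (singularCohomology ℤ ℤ (ComplexTorus Φ) (2 * finrank ℂ E)) = 1 := by
  rw [finrank_singularCohomology_int_eq_choose_two_mul, Nat.choose_self]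

/-- **`Hᵏ(X; ℤ)` has rank `0` for `k > 2g`** (it is free, hence zero).
[cite: Lange2023AbelianVarietiesComplex, §1.1.3 Exercise 1.1.6 (8) (PDF p. 27)] -/
theorem finrank_singularCohomology_int_eq_zero_of_lt {k : ℕ} (hk : 2 * finrank ℂ E < k) :
    finrank ℤ (singularCohomology ℤ ℤ (ComplexTorus Φ) k) = 0 := by
  rw [finrank_singularCohomology_int_eq_choose_two_mul, Nat.choose_eq_zero_of_lt hk]

/-- For `k > 2g`, `Hᵏ(X; ℤ) = 0` (a free module of rank `0`).
[cite: Lange2023AbelianVarietiesComplex, §1.1.3 Exercise 1.1.6 (8) (PDF p. 27)] -/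
theorem subsingleton_singularCohomology_int_of_lt {k : ℕ} (hk : 2 * finrank ℂ E < k) :
    Subsingleton (singularCohomology ℤ ℤ (ComplexTorus Φ) k) := by
  haveI : IsEmpty (Set.powersetCard (Fin (Fintype.card ι)) k) := by
    rw [← Fintype.card_eq_zero_iff, card_powersetCard_fin,
      Literature.AlgebraicGeometry.HodgeTheory.card_eq_two_mul_finrank_of_periodIso Φ]
    exact Nat.choose_eq_zero_of_lt hk
  exact (singularCohomologyIntBasis Φ k).repr.toEquiv.subsingleton_congr.2 inferInstance

end ComplexTorus

end Literature.Geometry.Kaehler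

end
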